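import Summits.AtomisticToContinuum.Crystallization.Theorems.ReggeStarCoercivityDefectFreeCrystallizesPalmDefs
import Summits.AtomisticToContinuum.Crystallization.Theorems.ReggeStarCoercivityDefectFreeCrystallizesJunkStrippingEnergy
import Summits.AtomisticToContinuum.Crystallization.Theorems.ReggeStarCoercivityDefectFreeCrystallizesFunnelFiniteGap
import Summits.AtomisticToContinuum.Crystallization.Theorems.MinimiserShells.Negative.LoadBearing
import Summits.AtomisticToContinuum.Crystallization.Theorems.PalmUnimodularRigidityMinimiserShellsDeepBadPricingOfShellNoBoundary
import Summits.AtomisticToContinuum.Crystallization.Theorems.PalmUnimodularRigidityMinimiserShellsSepReductionBad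
import Literature.MathematicalPhysics.StatisticalMechanics.PeriodicConfigurationSums
import Literature.MathematicalPhysics.StatisticalMechanics.LennardJonesClusters

/-!
# Junk stripping, predicate side (stub JS-P of line `palm-good-law`, crux stmt-AtomisticToContinuum-13603)

Stub `stub_junkStrippingPredicates` of the lead-c3 skeleton `Cruxes/DefectFreeCrystallizes/Lines/palm_good_law.lean` (v11).
"Junk" = motif sites of a periodic configuration `Q` of `ℝ³` that are not `SetGood` in `Q.points`.  Let `Q'` be a periodic
configuration whose point set is exactly the `SetGood` points of `Q` and whose motif is exactly the `SetGood` motif sites of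
`Q` (only these two identities are used; the lattice of `Q'` is never touched — all lattice bookkeeping uses `Q.lattice`).
Then, with the absolute constant `C = 62`:

* (a) `Q'.points` is `171/200`-separated: two `SetGood` points of `Q` are `≥ 171/200` apart (radial pinning
  `JunkStrippingEnergy.le_dist_of_setGood`);
* (b) at most `C · #junk` motif sites of `Q'` are not `SetGood` in `Q'.points`;
* (c) `#{x ∈ Q.motif : ¬ GoodShell(Q.points − x)} ≤ #{x ∈ Q'.motif : ¬ GoodShell(Q'.points − x)} + C · #junk`.

Proof of (b), (c).  Call a site `x` NEAR JUNK if some non-`SetGood` point `w` of `Q` has `dist w x ≤ 5/4`.  If a motif site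
`x` of `Q'` is not near junk, then `Q.points` and `Q'.points ⊆ Q.points` have the same points in the closed ball `B̄(x, 5/4)`
(`inter_closedBall_subset_points`), so both local predicates at `x` agree in `Q.points` and in `Q'.points`: `SetGood` by
`FunnelFiniteGap.setGood_congr_of_closedBall` (it reads the open `6/5`-ball, `6/5 ≤ 5/4`) and `GoodShell` of the re-rooted
point set by `ShellNoBoundary.goodShell_count_restrict_image_sub_congr` (it reads the closed `5/4`-ball).  Hence the
non-`SetGood` motif sites of `Q'` are near junk (a motif site of `Q'` is `SetGood` in `Q.points`), and a badly-shelled motif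
site of `Q` is junk, or near junk, or a badly-shelled motif site of `Q'`.  KEY COUNT (`card_filter_near_le`): at most
`61 · #junk` motif sites of `Q'` are near junk.  Indeed, write the junk point `w` near `x` as `w = z + g` with `z ∈ Q.motif`,
`g ∈ Q.lattice` (`exists_sub_mem_lattice`); `z` is junk (`SetGood Q.points` is `Q.lattice`-invariant, `setGood_add_iff`) and
`x - g` is a point of `Q'` (same invariance) with `dist (x - g) z = dist x w ≤ 5/4`.  The assignment `x ↦ x - g` is injective
on motif sites (`Q.eq_of_sub_mem`: `x - x' ∈ Q.lattice` forces `x = x'`), and for each junk motif site `z` its image in the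
fibre over `z` is a finite subset of the `171/200`-separated set `Q'.points` inside `B̄(z, 5/4)`, of cardinality
`≤ (2 · (5/4) / (171/200) + 1)³ = (671/171)³ < 61` (`card_le_of_separated_of_dist_le`).  So `#near ≤ 61 · #junk`
(`Finset.card_le_mul_card_image_of_maps_to`), (b) holds with `61 ≤ 62`, and (c) with `1 + 61 = 62`.
-/

noncomputable section

open MeasureTheory
open scoped ENNReal BigOperators Classical

namespace Summit.AtomisticToContinuum.Crystallization.Theorems.PalmGoodLaw.JunkStrippingPredicates

open Literature.MathematicalPhysics.StatisticalMechanics Literature.Geometry.DiscreteGeometry MeasureTheory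
open Summit.AtomisticToContinuum.Crystallization.Theorems.MinimiserShells.Negative.LoadBearing (eStar GoodShell)
open Summit.AtomisticToContinuum.Crystallization.Theorems.ChargedEnergyGapNegative (E3)
open Summit.AtomisticToContinuum.Crystallization.Theorems.PalmGoodLaw.JunkStrippingEnergy
  (le_dist_of_setGood setGood_add_iff)
open Summit.AtomisticToContinuum.Crystallization.Theorems.PalmGoodLaw.FunnelFiniteGap (setGood_congr_of_closedBall)
open Summit.AtomisticToContinuum.Crystallization.Theorems.PalmUnimodularRigidityMinimiserShells.ShellNoBoundary
  (goodShell_count_restrict_image_sub_congr)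
open Summit.AtomisticToContinuum.Crystallization.Theorems.PalmUnimodularRigidityMinimiserShells.SepReductionBad
  (natCard_subtype_eq_card_filter)

/-! ## The `SetGood` sub-configuration: membership, separation, lattice bookkeeping -/

/-- Points of the `SetGood` sub-configuration are the `SetGood` points of `Q`. [folklore] -/
theorem mem_points_iff {Q Q' : PeriodicConfiguration 3}
    (hpts : Q'.points = {x | x ∈ Q.points ∧ SetGood Q.points x}) (u : E3) :
    u ∈ Q'.points ↔ u ∈ Q.points ∧ SetGood Q.points u := by
  rw [hpts]
  rfl

/-- Motif sites of the `SetGood` sub-configuration are the `SetGood` motif sites of `Q`. [folklore] -/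
theorem mem_motif_iff {Q Q' : PeriodicConfiguration 3}
    (hmotif : (↑Q'.motif : Set (EuclideanSpace ℝ (Fin 3))) = {x | x ∈ Q.motif ∧ SetGood Q.points x}) (u : E3) :
    u ∈ Q'.motif ↔ u ∈ Q.motif ∧ SetGood Q.points u := by
  rw [← Finset.mem_coe, hmotif]
  rfl

/-- The `SetGood` sub-configuration is a sub-configuration. [folklore] -/
theorem points_subset {Q Q' : PeriodicConfiguration 3}
    (hpts : Q'.points = {x | x ∈ Q.points ∧ SetGood Q.points x}) : Q'.points ⊆ Q.points :=
  fun u hu => ((mem_points_iff hpts u).1 hu).1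

/-- **(a) Separation.**  The `SetGood` points of `Q` are pairwise `≥ 171/200` apart (radial pinning at a `SetGood`
point, `le_dist_of_setGood`). [folklore] -/
theorem le_dist_of_mem_points {Q Q' : PeriodicConfiguration 3}
    (hpts : Q'.points = {x | x ∈ Q.points ∧ SetGood Q.points x}) :
    ∀ x ∈ Q'.points, ∀ z ∈ Q'.points, x ≠ z → (171 / 200 : ℝ) ≤ dist x z := by
  intro x hx z hz hne
  rw [mem_points_iff hpts] at hx hz
  exact le_dist_of_setGood hz.2 hx.1 hne

/-- A `Q.lattice`-translate of a motif site of `Q'` is a point of `Q'` (`SetGood Q.points` and `Q.points` are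
`Q.lattice`-invariant, `setGood_add_iff`). [folklore] -/
theorem sub_mem_points {Q Q' : PeriodicConfiguration 3}
    (hpts : Q'.points = {x | x ∈ Q.points ∧ SetGood Q.points x})
    (hmotif : (↑Q'.motif : Set (EuclideanSpace ℝ (Fin 3))) = {x | x ∈ Q.motif ∧ SetGood Q.points x})
    {x g : E3} (hx : x ∈ Q'.motif) (hg : g ∈ Q.lattice) : x - g ∈ Q'.points := by
  rw [mem_points_iff hpts]
  obtain ⟨hxm, hxg⟩ := (mem_motif_iff hmotif x).1 hx
  have hneg : -g ∈ Q.lattice := Q.lattice.neg_mem hg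
  refine ⟨?_, ?_⟩
  · have h := Q.add_mem_points (Q.mem_points_of_mem_motif hxm) hneg
    rwa [← sub_eq_add_neg] at h
  · rw [sub_eq_add_neg, setGood_add_iff Q hneg]
    exact hxg

/-- Every non-`SetGood` point of `Q` is a `Q.lattice`-translate of a junk motif site (`exists_sub_mem_lattice`,
`setGood_add_iff`). [folklore] -/
theorem exists_junk_motif_rep (Q : PeriodicConfiguration 3) {w : E3} (hw : w ∈ Q.points)
    (hbad : ¬ SetGood Q.points w) :
    ∃ z ∈ Q.motif, ¬ SetGood Q.points z ∧ w - z ∈ Q.lattice := by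
  obtain ⟨z, hz, hg⟩ := Q.exists_sub_mem_lattice hw
  refine ⟨z, hz, fun hzg => hbad ?_, hg⟩
  have h := (setGood_add_iff Q hg z).2 hzg
  rwa [add_sub_cancel] at h

/-- **Locality input.**  If no non-`SetGood` point of `Q` lies within distance `5/4` of `x`, then every point of `Q` in
the closed ball `B̄(x, 5/4)` is a point of `Q'`. [folklore] -/
theorem inter_closedBall_subset_points {Q Q' : PeriodicConfiguration 3}
    (hpts : Q'.points = {x | x ∈ Q.points ∧ SetGood Q.points x}) {x : E3}
    (hfar : ¬ ∃ w ∈ Q.points, ¬ SetGood Q.points w ∧ dist w x ≤ 5 / 4) :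
    Q.points ∩ Metric.closedBall x (5 / 4) ⊆ Q'.points := by
  rintro w ⟨hw, hwx⟩
  rw [mem_points_iff hpts]
  refine ⟨hw, ?_⟩
  by_contra hbad
  exact hfar ⟨w, hw, hbad, Metric.mem_closedBall.1 hwx⟩

/-! ## The key count: few motif sites of `Q'` are near junk -/

/-- **Key count.**  At most `61 · #junk` motif sites `x` of `Q'` have a non-`SetGood` point of `Q` within distance `5/4`:
writing that point as `z + g` (`z` a junk motif site, `g ∈ Q.lattice`), `x ↦ x - g` is injective on motif sites
(`Q.eq_of_sub_mem`) and lands, fibre by fibre over `z`, in the points of the `171/200`-separated set `Q'.points` within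
`5/4` of `z`, at most `(671/171)³ < 61` of them (`card_le_of_separated_of_dist_le`). [folklore] -/
theorem card_filter_near_le {Q Q' : PeriodicConfiguration 3}
    (hpts : Q'.points = {x | x ∈ Q.points ∧ SetGood Q.points x})
    (hmotif : (↑Q'.motif : Set (EuclideanSpace ℝ (Fin 3))) = {x | x ∈ Q.motif ∧ SetGood Q.points x}) :
    (Q'.motif.filter fun x => ∃ w ∈ Q.points, ¬ SetGood Q.points w ∧ dist w x ≤ 5 / 4).card ≤
      61 * (Q.motif.filter fun x => ¬ SetGood Q.points x).card := by
  set A := Q'.motif.filter fun x => ∃ w ∈ Q.points, ¬ SetGood Q.points w ∧ dist w x ≤ 5 / 4 with hA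
  set J := Q.motif.filter fun x => ¬ SetGood Q.points x with hJ
  -- representatives: a junk motif site `z` and a period `g` with `dist (x - g) z ≤ 5/4`
  have hrep : ∀ x : E3, ∃ z g : E3, x ∈ A → (z ∈ J ∧ g ∈ Q.lattice ∧ dist (x - g) z ≤ 5 / 4) := by
    intro x
    by_cases hx : x ∈ A
    · obtain ⟨-, w, hw, hbad, hdist⟩ := Finset.mem_filter.1 hx
      obtain ⟨z, hz, hzbad, hg⟩ := exists_junk_motif_rep Q hw hbad
      refine ⟨z, w - z, fun _ => ⟨Finset.mem_filter.2 ⟨hz, hzbad⟩, hg, ?_⟩⟩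
      rw [dist_eq_norm, sub_sub, sub_add_cancel, ← dist_eq_norm, dist_comm]
      exact hdist
    · exact ⟨0, 0, fun h => absurd h hx⟩
  choose zf gf hzg using hrep
  -- `x ↦ x - gf x` is injective on `A` (motif sites of `Q` are pairwise inequivalent modulo `Q.lattice`)
  have hinj : Set.InjOn (fun x => x - gf x) ↑A := by
    intro x hx x' hx' h
    have hxm : x ∈ Q.motif := ((mem_motif_iff hmotif x).1 (Finset.mem_filter.1 hx).1).1
    have hxm' : x' ∈ Q.motif := ((mem_motif_iff hmotif x').1 (Finset.mem_filter.1 hx').1).1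
    refine Q.eq_of_sub_mem x hxm x' hxm' ?_
    have h' : x - gf x = x' - gf x' := h
    have hsub : x - x' = gf x - gf x' := by
      rw [sub_eq_sub_iff_sub_eq_sub] at h'
      exact h'
    rw [hsub]
    exact Q.lattice.sub_mem (hzg x hx).2.1 (hzg x' hx').2.1
  -- each fibre of `zf` has at most `61` elements
  have hfib : ∀ z₀ ∈ J, (A.filter fun x => zf x = z₀).card ≤ 61 := by
    intro z₀ _
    set F := A.filter fun x => zf x = z₀ with hF
    have hFA : F ⊆ A := Finset.filter_subset _ _
    rw [← Finset.card_image_of_injOn (hinj.mono (Finset.coe_subset.2 hFA))]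
    have h := card_le_of_separated_of_dist_le (F.image fun x => x - gf x) z₀
      (r := 171 / 200) (R := 5 / 4) (by norm_num) (by norm_num) ?_ ?_
    · rw [finrank_euclideanSpace_fin] at h
      have h' : ((F.image fun x => x - gf x).card : ℝ) ≤ 61 := h.trans (by norm_num)
      exact_mod_cast h'
    · intro c hc
      obtain ⟨x, hx, rfl⟩ := Finset.mem_image.1 hc
      obtain ⟨hxA, hxz⟩ := Finset.mem_filter.1 hx
      rw [← hxz]
      exact (hzg x hxA).2.2
    · intro c hc d hd hcd
      obtain ⟨x, hx, rfl⟩ := Finset.mem_image.1 hc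
      obtain ⟨x', hx', rfl⟩ := Finset.mem_image.1 hd
      exact le_dist_of_mem_points hpts _
        (sub_mem_points hpts hmotif (Finset.mem_filter.1 (hFA hx)).1 (hzg x (hFA hx)).2.1) _
        (sub_mem_points hpts hmotif (Finset.mem_filter.1 (hFA hx')).1 (hzg x' (hFA hx')).2.1) hcd
  exact Finset.card_le_mul_card_image_of_maps_to (fun x hx => (hzg x hx).1) 61 hfib

/-! ## (b) and (c) in `Finset.filter` form -/

/-- **(b)** The motif sites of `Q'` that are not `SetGood` in `Q'.points` are near junk (otherwise `Q.points` and
`Q'.points` agree in `B̄(x, 5/4) ⊇ B(x, 6/5)` and `SetGood` transfers, `setGood_congr_of_closedBall`), hence number at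
most `61 · #junk` (`card_filter_near_le`). [folklore] -/
theorem card_filter_notSetGood_le {Q Q' : PeriodicConfiguration 3}
    (hpts : Q'.points = {x | x ∈ Q.points ∧ SetGood Q.points x})
    (hmotif : (↑Q'.motif : Set (EuclideanSpace ℝ (Fin 3))) = {x | x ∈ Q.motif ∧ SetGood Q.points x}) :
    (Q'.motif.filter fun x => ¬ SetGood Q'.points x).card ≤
      61 * (Q.motif.filter fun x => ¬ SetGood Q.points x).card := by
  refine le_trans (Finset.card_le_card fun x hx => ?_) (card_filter_near_le hpts hmotif)
  obtain ⟨hxm, hbad⟩ := Finset.mem_filter.1 hx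
  refine Finset.mem_filter.2 ⟨hxm, ?_⟩
  by_contra hfar
  have hgood : SetGood Q.points x := ((mem_motif_iff hmotif x).1 hxm).2
  exact hbad ((setGood_congr_of_closedBall (points_subset hpts) (by norm_num : (6 : ℝ) / 5 ≤ 5 / 4)
    (inter_closedBall_subset_points hpts hfar)).1 hgood)

/-- **(c)** A badly-shelled motif site of `Q` is junk, or a motif site of `Q'` near junk, or — since then `Q.points` and
`Q'.points` agree in `B̄(x, 5/4)`, where `GoodShell` of the re-rooted point set is read
(`goodShell_count_restrict_image_sub_congr`) — a badly-shelled motif site of `Q'`; so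
`#bad(Q) ≤ #bad(Q') + (1 + 61) · #junk`. [folklore] -/
theorem card_filter_bad_le {Q Q' : PeriodicConfiguration 3}
    (hpts : Q'.points = {x | x ∈ Q.points ∧ SetGood Q.points x})
    (hmotif : (↑Q'.motif : Set (EuclideanSpace ℝ (Fin 3))) = {x | x ∈ Q.motif ∧ SetGood Q.points x}) :
    (Q.motif.filter fun x => ¬ GoodShell ((Measure.count : Measure E3).restrict
        ((fun z => z - x) '' Q.points))).card ≤
      (Q'.motif.filter fun x => ¬ GoodShell ((Measure.count : Measure E3).restrict
        ((fun z => z - x) '' Q'.points))).card +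
        62 * (Q.motif.filter fun x => ¬ SetGood Q.points x).card := by
  set BQ := Q.motif.filter fun x => ¬ GoodShell ((Measure.count : Measure E3).restrict
    ((fun z => z - x) '' Q.points)) with hBQ
  set BQ' := Q'.motif.filter fun x => ¬ GoodShell ((Measure.count : Measure E3).restrict
    ((fun z => z - x) '' Q'.points)) with hBQ'
  set J := Q.motif.filter fun x => ¬ SetGood Q.points x with hJ
  set A := Q'.motif.filter fun x => ∃ w ∈ Q.points, ¬ SetGood Q.points w ∧ dist w x ≤ 5 / 4 with hA
  have hcover : BQ ⊆ J ∪ A ∪ BQ' := by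
    intro x hx
    obtain ⟨hxm, hbad⟩ := Finset.mem_filter.1 hx
    rw [Finset.mem_union, Finset.mem_union]
    by_cases hgood : SetGood Q.points x
    · have hxm' : x ∈ Q'.motif := (mem_motif_iff hmotif x).2 ⟨hxm, hgood⟩
      by_cases hnear : ∃ w ∈ Q.points, ¬ SetGood Q.points w ∧ dist w x ≤ 5 / 4
      · exact Or.inl (Or.inr (Finset.mem_filter.2 ⟨hxm', hnear⟩))
      · refine Or.inr (Finset.mem_filter.2 ⟨hxm', fun hgood' => hbad ?_⟩)
        exact (goodShell_count_restrict_image_sub_congr (points_subset hpts) le_rfl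
          (inter_closedBall_subset_points hpts hnear)).2 hgood'
    · exact Or.inl (Or.inl (Finset.mem_filter.2 ⟨hxm, hgood⟩))
  have hAJ : A.card ≤ 61 * J.card := card_filter_near_le hpts hmotif
  calc BQ.card ≤ (J ∪ A ∪ BQ').card := Finset.card_le_card hcover
    _ ≤ (J ∪ A).card + BQ'.card := Finset.card_union_le _ _
    _ ≤ J.card + A.card + BQ'.card := Nat.add_le_add_right (Finset.card_union_le _ _) _
    _ ≤ J.card + 61 * J.card + BQ'.card := by omega
    _ = BQ'.card + 62 * J.card := by ring

/-! ## The stub -/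

/-- **Stub `stub_junkStrippingPredicates` (JS-P) of line `palm-good-law`.**  JUNK STRIPPING, PREDICATE SIDE, with
`C = 62`: if `Q'.points` is the set of `SetGood` points of `Q` and `Q'.motif` the set of `SetGood` motif sites of `Q`,
then (a) `Q'.points` is `171/200`-separated (`le_dist_of_mem_points`), (b) at most `C · #junk` motif sites of `Q'` are not
`SetGood` in `Q'.points` (`card_filter_notSetGood_le`), (c) `#bad(Q) ≤ #bad(Q') + C · #junk` for the `¬ GoodShell` counts
of the re-rooted point sets over the motifs (`card_filter_bad_le`); counts converted by `natCard_subtype_eq_card_filter`.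
[folklore] -/
theorem stub_junkStrippingPredicates :
    ∃ C : ℝ, 0 ≤ C ∧ ∀ Q Q' : Literature.MathematicalPhysics.StatisticalMechanics.PeriodicConfiguration 3,
      Q'.points = {x | x ∈ Q.points ∧ SetGood Q.points x} →
      (↑Q'.motif : Set (EuclideanSpace ℝ (Fin 3))) = {x | x ∈ Q.motif ∧ SetGood Q.points x} →
      (∀ x ∈ Q'.points, ∀ z ∈ Q'.points, x ≠ z → (171 / 200 : ℝ) ≤ dist x z) ∧
      (Nat.card {x : Q'.motif // ¬ SetGood Q'.points (x : EuclideanSpace ℝ (Fin 3))} : ℝ) ≤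
        C * (Nat.card {x : Q.motif // ¬ SetGood Q.points (x : EuclideanSpace ℝ (Fin 3))} : ℝ) ∧
      (Nat.card {x : Q.motif // ¬ GoodShell
          ((Measure.count : Measure (EuclideanSpace ℝ (Fin 3))).restrict
            ((fun z => z - (x : EuclideanSpace ℝ (Fin 3))) '' Q.points))} : ℝ) ≤
        (Nat.card {x : Q'.motif // ¬ GoodShell
          ((Measure.count : Measure (EuclideanSpace ℝ (Fin 3))).restrict
            ((fun z => z - (x : EuclideanSpace ℝ (Fin 3))) '' Q'.points))} : ℝ) +
        C * (Nat.card {x : Q.motif // ¬ SetGood Q.points (x : EuclideanSpace ℝ (Fin 3))} : ℝ) := by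
  refine ⟨62, by norm_num, fun Q Q' hpts hmotif => ⟨le_dist_of_mem_points hpts, ?_, ?_⟩⟩
  · have h1 : Nat.card {x : Q'.motif // ¬ SetGood Q'.points (x : EuclideanSpace ℝ (Fin 3))} =
        (Q'.motif.filter fun x => ¬ SetGood Q'.points x).card :=
      natCard_subtype_eq_card_filter Q'.motif fun x => ¬ SetGood Q'.points x
    have h2 : Nat.card {x : Q.motif // ¬ SetGood Q.points (x : EuclideanSpace ℝ (Fin 3))} =
        (Q.motif.filter fun x => ¬ SetGood Q.points x).card :=
      natCard_subtype_eq_card_filter Q.motif fun x => ¬ SetGood Q.points x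
    have key := card_filter_notSetGood_le hpts hmotif
    rw [h1, h2]
    have key' : ((Q'.motif.filter fun x => ¬ SetGood Q'.points x).card : ℝ) ≤
        61 * ((Q.motif.filter fun x => ¬ SetGood Q.points x).card : ℝ) := by exact_mod_cast key
    have hnn : (0 : ℝ) ≤ ((Q.motif.filter fun x => ¬ SetGood Q.points x).card : ℝ) := Nat.cast_nonneg _
    linarith
  · have h1 : Nat.card {x : Q.motif // ¬ GoodShell ((Measure.count : Measure (EuclideanSpace ℝ (Fin 3))).restrict
        ((fun z => z - (x : EuclideanSpace ℝ (Fin 3))) '' Q.points))} =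
        (Q.motif.filter fun x => ¬ GoodShell ((Measure.count : Measure E3).restrict
          ((fun z => z - x) '' Q.points))).card :=
      natCard_subtype_eq_card_filter Q.motif fun x => ¬ GoodShell ((Measure.count : Measure E3).restrict
        ((fun z => z - x) '' Q.points))
    have h2 : Nat.card {x : Q'.motif // ¬ GoodShell ((Measure.count : Measure (EuclideanSpace ℝ (Fin 3))).restrict
        ((fun z => z - (x : EuclideanSpace ℝ (Fin 3))) '' Q'.points))} =
        (Q'.motif.filter fun x => ¬ GoodShell ((Measure.count : Measure E3).restrict
          ((fun z => z - x) '' Q'.points))).card :=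
      natCard_subtype_eq_card_filter Q'.motif fun x => ¬ GoodShell ((Measure.count : Measure E3).restrict
        ((fun z => z - x) '' Q'.points))
    have h3 : Nat.card {x : Q.motif // ¬ SetGood Q.points (x : EuclideanSpace ℝ (Fin 3))} =
        (Q.motif.filter fun x => ¬ SetGood Q.points x).card :=
      natCard_subtype_eq_card_filter Q.motif fun x => ¬ SetGood Q.points x
    have key := card_filter_bad_le hpts hmotif
    rw [h1, h2, h3]
    exact_mod_cast key

end Summit.AtomisticToContinuum.Crystallization.Theorems.PalmGoodLaw.JunkStrippingPredicates

end
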